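import Summits.AtomisticToContinuum.Crystallization.Theses.PalmUnimodularRigidity
import Literature.Probability.Process.PointStationaryLaw
import Literature.Probability.Process.RootedHardCoreConfig

/-!
# Route PalmUnimodularRigidity — the glue `CruxesToPalmRigidity`

Settles item `stmt-AtomisticToContinuum-9228` of route
`AtomisticToContinuum/Crystallization/PalmUnimodularRigidity`:

  `MinimiserShells → ShellsToBarlowChart → LayeredLawsSelectHcp → PalmRigidity`.

Content (the two things the planner foresaw):

* **"Root a.s. ⇒ every point a.s."** (`ae_forall_map_sub_of_ae`, the Aldous–Lyons
  "everything shows at the root" lemma [AldousLyons2007, Lemma 2.3] for point-stationary laws in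
  the Mecke / mass-transport form of `Literature.Probability.Process.IsPointStationaryLaw`): apply
  the Mecke identity to `g (ν, z) = 1[ν ∈ B']` with `B'` a MEASURABLE `P`-null superset of the bad
  event — so the measurability of the shell event itself is never needed. The sent mass is `0`
  a.s.; the received mass `F μ = Σ_{y ∈ μ} 1[θ_y μ ∈ B']` therefore integrates to `0`, and it is
  a.e.-measurable because on locally finite configurations the (non-s-finite) identity kernel
  `Measure E → Measure E` agrees with an s-finite kernel (`exists_isSFiniteKernel_apply_eq_self`:
  cut each norm-shell `{⌊‖z‖⌋ = n}` off at its integer mass level), which makes Mathlib's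
  `Measurable.lintegral_kernel_prod_right` / `Kernel.measurable_kernel_prodMk_left` available.
* **Re-rooting counting measures** (`shell_image_sub_eq`): the points of `θ_x (count|S)` in the
  punctured ball of radius `r` are the translates by `-x` of the points of `S ∖ {x}` within `r` of
  `x` (`Literature.Probability.Process.map_sub_count_restrict`).

Then `MinimiserShells` gives good root shells a.s., the transfer gives good shells at every point
a.s., `ShellsToBarlowChart` (pure geometry, `0 ∈ S`) gives the Barlow chart, and
`LayeredLawsSelectHcp` concludes.

References: D. Aldous, R. Lyons, *Processes on unimodular random networks*, EJP 12 (2007), §2;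
G. Last, H. Thorisson, Ann. Probab. 37 (2009) (point-stationarity).
-/

open scoped ENNReal
open MeasureTheory ProbabilityTheory Set Filter Literature.Probability.Process

namespace Summit.AtomisticToContinuum.Crystallization.Theorems.PalmUnimodularRigidity

/-! ### An s-finite kernel that is the identity on locally finite measures -/

section Kernel

/-- **An s-finite kernel that is the identity on locally finite measures.** Given a countable
measurable partition `A` of `α`, there is an s-finite kernel `κ` from `Measure α` (Giry σ-algebra)
to `α` with `κ μ = μ` for every `μ` giving finite mass to every cell. (The identity
`Measure α → Measure α` is a kernel but not s-finite; `κ` cuts each cell off at its integer mass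
level, `κ = Σ_{n,m} 1[μ (A n) < ∞, ⌊μ (A n)⌋ = m] · μ|_(A n)`, a countable sum of finite kernels.)
This is the device that makes Campbell-type integrals `μ ↦ ∫⁻ y, f μ y ∂μ` measurable on locally
finite configurations. [folklore] -/
theorem exists_isSFiniteKernel_apply_eq_self {α : Type*} [MeasurableSpace α] (A : ℕ → Set α)
    (hA : ∀ n, MeasurableSet (A n)) (hdisj : Pairwise (Function.onFun Disjoint A))
    (hcov : ∀ x, ∃ n, x ∈ A n) :
    ∃ κ : Kernel (Measure α) α, IsSFiniteKernel κ ∧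
      ∀ μ : Measure α, (∀ n, μ (A n) < ∞) → κ μ = μ := by
  classical
  have hmeas_restrict : ∀ n, Measurable fun μ : Measure α => μ.restrict (A n) := fun n =>
    Measure.measurable_of_measurable_coe _ fun s hs => by
      simp_rw [Measure.restrict_apply hs]
      exact Measure.measurable_coe (hs.inter (hA n))
  have hmeas_lev : ∀ n m : ℕ,
      MeasurableSet {μ : Measure α | μ (A n) < ∞ ∧ ⌊(μ (A n)).toReal⌋₊ = m} := fun n m =>
    (measurableSet_lt (Measure.measurable_coe (hA n)) measurable_const).inter
      ((Nat.measurable_floor.comp (Measure.measurable_coe (hA n)).ennreal_toReal)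
        (measurableSet_singleton m))
  let κ : ℕ → ℕ → Kernel (Measure α) α := fun n m =>
    { toFun := fun μ => if μ (A n) < ∞ ∧ ⌊(μ (A n)).toReal⌋₊ = m then μ.restrict (A n) else 0
      measurable' := Measurable.ite (hmeas_lev n m) (hmeas_restrict n) measurable_const }
  have hκ_apply : ∀ n m μ, κ n m μ =
      if μ (A n) < ∞ ∧ ⌊(μ (A n)).toReal⌋₊ = m then μ.restrict (A n) else 0 := fun n m μ => rfl
  have hfin : ∀ n m, IsFiniteKernel (κ n m) := by
    intro n m
    refine ⟨⟨(m : ℝ≥0∞) + 1, by simp, fun μ => ?_⟩⟩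
    rw [hκ_apply]
    split_ifs with h
    · rw [Measure.restrict_apply_univ]
      obtain ⟨hlt, hfl⟩ := h
      have h1 : (μ (A n)).toReal < m + 1 := hfl ▸ Nat.lt_floor_add_one _
      rw [← ENNReal.ofReal_toReal hlt.ne]
      have h3 : ENNReal.ofReal ((m : ℝ) + 1) = (m : ℝ≥0∞) + 1 := by
        rw [ENNReal.ofReal_add (by positivity) zero_le_one, ENNReal.ofReal_natCast,
          ENNReal.ofReal_one]
      rw [← h3]
      exact ((ENNReal.ofReal_lt_ofReal_iff (by positivity)).2 h1).le
    · simp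
  haveI : ∀ p : ℕ × ℕ, IsFiniteKernel (κ p.1 p.2) := fun p => hfin p.1 p.2
  refine ⟨Kernel.sum fun p : ℕ × ℕ => κ p.1 p.2, inferInstance, fun μ hμ => ?_⟩
  ext s hs
  rw [Kernel.sum_apply, Measure.sum_apply _ hs, ENNReal.tsum_prod']
  have hinner : ∀ n, ∑' m, (κ n m μ) s = μ (s ∩ A n) := by
    intro n
    have hterm : ∀ m, (κ n m μ) s = if m = ⌊(μ (A n)).toReal⌋₊ then μ (s ∩ A n) else 0 := by
      intro m
      rw [hκ_apply]
      by_cases h : m = ⌊(μ (A n)).toReal⌋₊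
      · rw [if_pos ⟨hμ n, h.symm⟩, if_pos h, Measure.restrict_apply hs]
      · rw [if_neg (fun h' => h h'.2.symm), if_neg h, Measure.coe_zero, Pi.zero_apply]
    simp_rw [hterm]
    exact tsum_ite_eq _ _
  simp_rw [hinner]
  have hd : Pairwise (Function.onFun Disjoint fun n => s ∩ A n) := fun i j hij =>
    (hdisj hij).mono inter_subset_right inter_subset_right
  rw [← measure_iUnion hd fun n => hs.inter (hA n), ← inter_iUnion,
    iUnion_eq_univ_iff.2 hcov, inter_univ]

variable {E : Type*} [MeasurableSpace E] [Sub E] [MeasurableSub₂ E]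

/-- For an s-finite kernel `κ` from configurations to points, the re-rooting map
`(μ, y) ↦ θ_y (κ μ) = (κ μ).map (· - y)` is jointly measurable (Giry σ-algebra on both sides):
its evaluation at a measurable `s` is `κ μ {z | z - y ∈ s}`, a section measure of the s-finite
kernel `Kernel.prodMkRight E κ`. [folklore] -/
theorem measurable_map_sub_kernel (κ : Kernel (Measure E) E) [IsSFiniteKernel κ] :
    Measurable fun p : Measure E × E => (κ p.1).map (fun z => z - p.2) := by
  refine Measure.measurable_of_measurable_coe _ fun s hs => ?_
  have ht : MeasurableSet {q : (Measure E × E) × E | q.2 - q.1.2 ∈ s} :=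
    (measurable_snd.sub (measurable_snd.comp measurable_fst)) hs
  have heq : (fun p : Measure E × E => (κ p.1).map (fun z => z - p.2) s) = fun p =>
      Kernel.prodMkRight E κ p (Prod.mk p ⁻¹' {q : (Measure E × E) × E | q.2 - q.1.2 ∈ s}) := by
    funext p
    rw [Measure.map_apply (measurable_sub_const p.2) hs, Kernel.prodMkRight_apply]
    rfl
  rw [heq]
  exact Kernel.measurable_kernel_prodMk_left ht

end Kernel

/-! ### Everything shows at the root -/

section Transfer

variable {E : Type*} [NormedAddCommGroup E] [MeasurableSpace E] [BorelSpace E]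

/-- The norm shells `{z | ⌊‖z‖⌋₊ = n}` (a countable partition of `E` into bounded pieces) are
measurable. [folklore] -/
theorem measurableSet_floorNorm_preimage (n : ℕ) :
    MeasurableSet ((fun z : E => ⌊‖z‖⌋₊) ⁻¹' {n}) :=
  (Nat.measurable_floor.comp measurable_norm) (measurableSet_singleton n)

/-- A hard-core configuration is locally finite: the counting measure of a `δ`-separated set
(`δ > 0`) of a proper space gives finite mass to every norm shell `{⌊‖z‖⌋₊ = n} ⊆ B̄(0, n + 1)`
(`LocalConfig.finite_inter_of_separated`). [folklore] -/
theorem count_restrict_floorNorm_preimage_lt_top [ProperSpace E] {S : Set E} {δ : ℝ}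
    (hδ : 0 < δ) (hS : ∀ x ∈ S, ∀ y ∈ S, x ≠ y → δ ≤ dist x y) (n : ℕ) :
    (Measure.count : Measure E).restrict S ((fun z : E => ⌊‖z‖⌋₊) ⁻¹' {n}) < ∞ := by
  rw [Measure.restrict_apply (measurableSet_floorNorm_preimage n)]
  refine (measure_mono ?_).trans_lt (Measure.count_apply_lt_top.2
    (LocalConfig.finite_inter_of_separated hδ hS (isCompact_closedBall (0 : E) ((n : ℝ) + 1))))
  rintro z ⟨hz, hzS⟩
  refine ⟨mem_closedBall_zero_iff.2 ?_, hzS⟩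
  have h1 : (⌊‖z‖⌋₊ : ℝ) = n := by exact_mod_cast hz
  have h2 := Nat.lt_floor_add_one ‖z‖
  linarith

variable [SecondCountableTopology E]

/-- **Everything shows at the root** (Aldous–Lyons "root a.s. ⇒ every point a.s."): let `P` be a
law of configurations `μ : Measure E` satisfying the Mecke / mass-transport identity
(`IsPointStationaryLaw`, inlined) and carried by locally finite configurations. If a property `p`
holds for `P`-a.e. ROOTED configuration, then `P`-a.s. it holds for the configuration RE-ROOTED
AT EVERY ONE OF ITS POINTS, `p (θ_y μ)` for all `y` with `μ {y} ≠ 0`. Proof: mass transport with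
`g (ν, z) = 1[ν ∈ B']`, `B' ⊇ {¬ p}` a measurable `P`-null set (no measurability of `p` needed):
mass sent from the root is `0` a.s., so the mass received `Σ_{y ∈ μ} 1[θ_y μ ∈ B']` — an
a.e.-measurable function of `μ` by `exists_isSFiniteKernel_apply_eq_self` — vanishes a.s.
[folklore; AldousLyons2007 §2, Lemma 2.3] -/
theorem ae_forall_map_sub_of_ae {P : Measure (Measure E)}
    (hstat : ∀ g : Measure E → E → ℝ≥0∞, Measurable (Function.uncurry g) →
      ∫⁻ μ, ∫⁻ y, g μ y ∂μ ∂P = ∫⁻ μ, ∫⁻ y, g (Measure.map (fun z => z - y) μ) (-y) ∂μ ∂P)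
    (hlf : ∀ᵐ μ ∂P, ∀ n : ℕ, μ ((fun z : E => ⌊‖z‖⌋₊) ⁻¹' {n}) < ∞)
    {p : Measure E → Prop} (hp : ∀ᵐ μ ∂P, p μ) :
    ∀ᵐ μ ∂P, ∀ y : E, μ {y} ≠ 0 → p (Measure.map (fun z => z - y) μ) := by
  -- a measurable null superset `B'` of the bad event `{¬ p}`
  obtain ⟨B', hBB', hB'm, hPB'⟩ := exists_measurable_superset_of_null (ae_iff.1 hp)
  -- an s-finite kernel agreeing with the identity on locally finite configurations
  obtain ⟨κ, hκ, hκid⟩ := exists_isSFiniteKernel_apply_eq_self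
    (fun n : ℕ => (fun z : E => ⌊‖z‖⌋₊) ⁻¹' {n}) measurableSet_floorNorm_preimage
    (fun i j hij => Set.disjoint_iff.2 fun z hz => hij (hz.1.symm.trans hz.2))
    (fun z => ⟨⌊‖z‖⌋₊, rfl⟩)
  -- mass transport with `g (ν, z) = 1[ν ∈ B']`: nothing is sent, a.s.
  set g : Measure E → E → ℝ≥0∞ := fun ν _ => B'.indicator 1 ν with hg_def
  have hg : Measurable (Function.uncurry g) :=
    (measurable_one.indicator hB'm).comp measurable_fst
  have hL : ∫⁻ μ, ∫⁻ y, g μ y ∂μ ∂P = 0 := by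
    refine (lintegral_congr_ae ?_).trans lintegral_zero
    filter_upwards [measure_eq_zero_iff_ae_notMem.1 hPB'] with μ hμ
    simp [hg_def, Set.indicator_of_notMem hμ]
  -- hence nothing is received, in `P`-mean
  have hR : ∫⁻ μ, ∫⁻ y, g (Measure.map (fun z => z - y) μ) (-y) ∂μ ∂P = 0 := by
    rwa [hstat g hg] at hL
  -- the received mass is a.e.-measurable (it is a kernel integral on locally finite `μ`)
  have hF' : Measurable fun μ : Measure E =>
      ∫⁻ y, B'.indicator (1 : Measure E → ℝ≥0∞) ((κ μ).map (fun z => z - y)) ∂(κ μ) :=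
    Measurable.lintegral_kernel_prod_right
      ((measurable_one.indicator hB'm).comp (measurable_map_sub_kernel κ))
  have hFae : AEMeasurable (fun μ : Measure E =>
      ∫⁻ y, g (Measure.map (fun z => z - y) μ) (-y) ∂μ) P := by
    refine ⟨_, hF', ?_⟩
    filter_upwards [hlf] with μ hμ
    simp only [hg_def, hκid μ hμ]
  -- so it vanishes a.s., i.e. no point `y` of `μ` has `θ_y μ ∈ B'`
  have hF0 := (lintegral_eq_zero_iff' hFae).1 hR
  filter_upwards [hF0] with μ hμ y hy
  by_contra hnot
  have h1 : g (Measure.map (fun z => z - y) μ) (-y) * μ {y} ≤ 0 := by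
    calc g (Measure.map (fun z => z - y) μ) (-y) * μ {y}
        = ∫⁻ z in {y}, g (Measure.map (fun w => w - z) μ) (-z) ∂μ :=
          (lintegral_singleton (fun z => g (Measure.map (fun w => w - z) μ) (-z)) y).symm
      _ ≤ ∫⁻ z, g (Measure.map (fun w => w - z) μ) (-z) ∂μ := setLIntegral_le_lintegral _ _
      _ = 0 := hμ
  have h2 : g (Measure.map (fun z => z - y) μ) (-y) = 1 := by
    simp [hg_def, Set.indicator_of_mem (hBB' hnot)]
  rw [h2, one_mul] at h1
  exact hy (nonpos_iff_eq_zero.1 h1)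

end Transfer

/-! ### Re-rooting a counting measure: the shell seen from a point -/

section Shell

variable {E : Type*} [NormedAddCommGroup E] [MeasurableSpace E] [MeasurableSingletonClass E]

/-- **The shell of `θ_x (count|S)` is the translated shell of `S` at `x`.** For the configuration
`count|S` re-rooted at `x` (`= count|(S - x)`, `map_sub_count_restrict`), its points `y ≠ 0`
with `‖y‖ ≤ r` are exactly the translates `y - x` of the points `y ∈ S`, `y ≠ x`, with
`dist y x ≤ r`. This identifies the root-shell clause of `MinimiserShells` at the re-rooted
configuration with the shell-at-`x` clause of `ShellsToBarlowChart` / `LayeredLawsSelectHcp`.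
[folklore] -/
theorem shell_image_sub_eq (S : Set E) (x : E) (r : ℝ) :
    {y : E | (Measure.count : Measure E).restrict ((fun z : E => z - x) '' S) {y} ≠ 0 ∧
        y ≠ 0 ∧ ‖y‖ ≤ r} =
      (fun y : E => y - x) '' {y : E | y ∈ S ∧ y ≠ x ∧ dist y x ≤ r} := by
  ext y
  simp only [mem_setOf_eq, count_restrict_singleton_ne_zero_iff, mem_image]
  constructor
  · rintro ⟨⟨w, hw, rfl⟩, hne, hnorm⟩
    exact ⟨w, ⟨hw, fun h => hne (by rw [h, sub_self]), by rwa [dist_eq_norm]⟩, rfl⟩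
  · rintro ⟨w, ⟨hw, hne, hdist⟩, rfl⟩
    exact ⟨⟨w, hw, rfl⟩, sub_ne_zero.2 hne, by rwa [← dist_eq_norm]⟩

end Shell

/-! ### The glue -/

/-- **Settles item `stmt-AtomisticToContinuum-9228` (`CruxesToPalmRigidity`).**
`MinimiserShells → ShellsToBarlowChart → LayeredLawsSelectHcp → PalmRigidity`: given a minimising
point-stationary hard-core law `P`, `MinimiserShells` makes the ROOT shell close-packed a.s.;
by "everything shows at the root" (`ae_forall_map_sub_of_ae`, using that hard-core
configurations are locally finite) the shell at EVERY point is close-packed a.s. (after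
identifying the re-rooted counting measure's shell, `shell_image_sub_eq`); `ShellsToBarlowChart`
(applicable since `0 ∈ S`) supplies the global Barlow chart; `LayeredLawsSelectHcp` then yields
the rotated relaxed HCP conclusion, i.e. `PalmRigidity`. -/
theorem cruxesToPalmRigidity_proof :
    Summit.AtomisticToContinuum.Crystallization.Theses.PalmUnimodularRigidity.CruxesToPalmRigidity := by
  intro hShells hChart hSelect δ hδ P hP hcore hstat hmin
  -- good root shell, a.s.
  have hroot := hShells δ hδ P hP hcore hstat hmin
  -- hard-core configurations are locally finite
  have hlf : ∀ᵐ μ ∂P, ∀ n : ℕ,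
      μ ((fun z : EuclideanSpace ℝ (Fin 3) => ⌊‖z‖⌋₊) ⁻¹' {n}) < ∞ := by
    filter_upwards [hcore] with μ hμ n
    obtain ⟨S, -, hsep, rfl⟩ := hμ
    exact count_restrict_floorNorm_preimage_lt_top hδ hsep n
  -- good shell at every point, a.s.
  have hall := ae_forall_map_sub_of_ae hstat hlf hroot
  refine hSelect δ hδ P hP hcore hstat hmin ?_
  filter_upwards [hcore, hall] with μ hc ha
  obtain ⟨S, h0, hsep, rfl⟩ := hc
  refine ⟨S, rfl, ?good, hChart S ⟨0, h0⟩ ?good⟩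
  intro x hx
  obtain ⟨a, ha1, ha2, T, hT, hsh⟩ := ha x ((count_restrict_singleton_ne_zero_iff S x).2 hx)
  refine ⟨a, ha1, ha2, T, ?_, hsh⟩
  rw [hT, map_sub_count_restrict, shell_image_sub_eq]

end Summit.AtomisticToContinuum.Crystallization.Theorems.PalmUnimodularRigidity
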